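import Mathlib
import Summits.Ventures.PercRepro.TriangleCapBipartiteTwo

/-!
# PercRepro — THREE BELOW THE DIAGONAL ON EVERY BIPARTITION: `Σ_v d(v)² + 3(k − 4) ≤ m·k` for every bipartite
spanning graph in the dense corner with at least three missing cross pairs (p3, gen 36; part 37)

The pattern of TriangleCapBipartiteTwo one step further.  With `G := Σ_{x ∈ X} miss(x)·d(x) + Σ_{y ∉ X} miss(y)·d(y)`
(`Σ deficit = 2G`, every missing cross pair paying the degrees of its ends):

* `N₀ ≤ k − 4`: the star bound `N₀ (k − N₀ − 1) ≥ 3 (k − 4)`;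
* `N₀ ≥ k − 3` and a missing pair `(x, y)` with `d(x) ≤ 1`, `d(y) ≤ 1`: every `y′ ∉ N(x)` misses `x` and pays `d(y′)`,
  so `G ≥ (m − |X|) + (m − |Xᶜ|) = 2m − k ≥ 3 (k − 4)` in the dense corner (`sum_missY_deg_ge`, `sum_miss_deg_ge`);
* otherwise every missing pair has an end of degree `≥ 2`: with no isolated vertex every missing pair pays `≥ 3`,
  `G ≥ 3 N₀ ≥ 3 (k − 3)`; with an isolated vertex `z ∈ X` every `y ∉ X` misses `z` and has `d(y) ≥ 2`, so
  `G + 2 |Xᶜ| ≥ m + 2 N₀`, and `m ≤ (|X| − 1)|Xᶜ|` with `m ≥ 2k − 3` forces `|X| ≥ 4`, `|Xᶜ| ≥ 3`, whence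
  `G ≥ 3 (k − 4)` (`arith_three`; tight on `K_{3, q}` plus an isolated vertex `= K_{3, q+1}` minus a `3`-star).

* **`bipartite_stability_three`** — `Σ_v d(v)² + 3 (k − 4) ≤ m·k` for every bipartite spanning graph with `N₀ ≥ 3`
  and `2k ≤ m + 3`; in cherries `bipartite_stability_three_cherries`;
* **`three_below_diagonal_bipartite_exact`** — for `1 ≤ a`, `a + 3 ≤ k`, `m = a(k − a) − 3 ≥ 2k − 3` with `m`, `m + 1`,
  `m + 2` not of the form `a′(k − a′)`: the maximum of `2·Σ_v C(d(v), 2)` over the bipartite spanning graphs on `Fin k`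
  with `m` edges (any bipartition) IS `m (k − 2) − 3 (k − 4)`, by `K_{a, k−a}` minus three edges at one vertex — the
  sub-diagonal `r = 3` of the closed form P3-TRIANGLE-CAP.md §10av on the bipartite class: `(9,15) 45 · (10,18) 63 ·
  (11,21) 84 · (12,24) 108 · (13,27) 135 · …`.
Axioms: standard.
-/

namespace PercRepro

namespace TriangleCap

namespace C047

open Finset

variable {V : Type*} [Fintype V] [DecidableEq V]

/-- For `x ∈ X` the degree is the number of neighbours in `Xᶜ`. -/
theorem deg_eq_card_filter_compl (D : SimpleGraph V) [DecidableRel D.Adj] (X : Finset V)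
    (hbip : ∀ x y, D.Adj x y → (x ∈ X ↔ y ∉ X)) {x : V} (hx : x ∈ X) :
    deg D x = (Xᶜ.filter (fun w => D.Adj x w)).card := by
  unfold deg
  congr 1
  ext w
  simp only [mem_filter, mem_univ, true_and, mem_compl]
  exact ⟨fun h => ⟨(hbip x w h).mp hx, h⟩, fun h => h.2⟩

/-- For `y ∉ X` the degree is the number of neighbours in `X`. -/
theorem deg_eq_card_filter_left (D : SimpleGraph V) [DecidableRel D.Adj] (X : Finset V)
    (hbip : ∀ x y, D.Adj x y → (x ∈ X ↔ y ∉ X)) {y : V} (hy : y ∉ X) :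
    deg D y = (X.filter (fun x => D.Adj x y)).card := by
  unfold deg
  congr 1
  ext w
  simp only [mem_filter, mem_univ, true_and]
  constructor
  · intro h
    refine ⟨?_, h.symm⟩
    by_contra hw
    exact hy ((hbip y w h).mpr hw)
  · intro h
    exact h.2.symm

omit [DecidableEq V] in
/-- `Σ_{(x,y) missing} d(x) = Σ_{x ∈ X} miss(x)·d(x)`. -/
theorem sum_deg_fst_missing (D : SimpleGraph V) [DecidableRel D.Adj] (X Y : Finset V) :
    ∑ h ∈ missing D X Y, deg D h.1 = ∑ x ∈ X, miss D Y x * deg D x := by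
  unfold missing miss
  rw [sum_filter, sum_product]
  apply sum_congr rfl
  intro x _
  dsimp only
  rw [← sum_filter, sum_const, smul_eq_mul]

omit [DecidableEq V] in
/-- `Σ_{(x,y) missing} d(y) = Σ_{y ∈ Y} |{x ∈ X : ¬ x ~ y}|·d(y)`. -/
theorem sum_deg_snd_missing (D : SimpleGraph V) [DecidableRel D.Adj] (X Y : Finset V) :
    ∑ h ∈ missing D X Y, deg D h.2 = ∑ y ∈ Y, (X.filter (fun x => ¬ D.Adj x y)).card * deg D y := by
  unfold missing
  rw [sum_filter, sum_product_right]
  apply sum_congr rfl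
  intro y _
  dsimp only
  rw [← sum_filter, sum_const, smul_eq_mul]

/-- A vertex `x ∈ X` of degree `≤ 1`: the vertices of `Xᶜ` missing `x` carry all but at most `|X|` of `m`. -/
theorem sum_missY_deg_ge (D : SimpleGraph V) [DecidableRel D.Adj] (X : Finset V)
    (hbip : ∀ x y, D.Adj x y → (x ∈ X ↔ y ∉ X)) {x : V} (hx : x ∈ X) (hdx : deg D x ≤ 1) :
    D.edgeFinset.card ≤ ∑ y ∈ Xᶜ, (X.filter (fun x' => ¬ D.Adj x' y)).card * deg D y + X.card := by
  have hsplit := sum_filter_add_sum_filter_not Xᶜ (fun y => D.Adj x y) (deg D)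
  rw [sum_deg_right_eq_card_edges D X hbip] at hsplit
  -- the neighbours of `x` carry at most `d(x)·|X| ≤ |X|`
  have h1 : ∑ y ∈ Xᶜ.filter (fun y => D.Adj x y), deg D y ≤ X.card := by
    calc ∑ y ∈ Xᶜ.filter (fun y => D.Adj x y), deg D y
        ≤ ∑ y ∈ Xᶜ.filter (fun y => D.Adj x y), X.card := by
          apply sum_le_sum
          intro y hy
          have hy' : y ∉ X := by
            have := (mem_filter.mp hy).1
            exact mem_compl.mp this
          rw [deg_eq_card_filter_left D X hbip hy']
          exact card_filter_le _ _
      _ = (Xᶜ.filter (fun y => D.Adj x y)).card * X.card := by rw [sum_const, smul_eq_mul]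
      _ ≤ 1 * X.card := by
          apply Nat.mul_le_mul_right
          rw [← deg_eq_card_filter_compl D X hbip hx]
          exact hdx
      _ = X.card := one_mul _
  -- the non-neighbours of `x` all miss `x`, so each pays its degree
  have h2 : ∑ y ∈ Xᶜ.filter (fun y => ¬ D.Adj x y), deg D y ≤
      ∑ y ∈ Xᶜ, (X.filter (fun x' => ¬ D.Adj x' y)).card * deg D y := by
    calc ∑ y ∈ Xᶜ.filter (fun y => ¬ D.Adj x y), deg D y
        ≤ ∑ y ∈ Xᶜ.filter (fun y => ¬ D.Adj x y), (X.filter (fun x' => ¬ D.Adj x' y)).card * deg D y := by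
          apply sum_le_sum
          intro y hy
          have hpos : 0 < (X.filter (fun x' => ¬ D.Adj x' y)).card :=
            card_pos.mpr ⟨x, mem_filter.mpr ⟨hx, (mem_filter.mp hy).2⟩⟩
          exact Nat.le_mul_of_pos_left _ hpos
      _ ≤ ∑ y ∈ Xᶜ, (X.filter (fun x' => ¬ D.Adj x' y)).card * deg D y :=
          sum_le_sum_of_subset_of_nonneg (filter_subset _ _) (fun _ _ _ => Nat.zero_le _)
  omega

/-- A vertex `y ∉ X` of degree `≤ 1`: the vertices of `X` missing `y` carry all but at most `|Xᶜ|` of `m`. -/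
theorem sum_miss_deg_ge (D : SimpleGraph V) [DecidableRel D.Adj] (X : Finset V)
    (hbip : ∀ x y, D.Adj x y → (x ∈ X ↔ y ∉ X)) {y : V} (hy : y ∉ X) (hdy : deg D y ≤ 1) :
    D.edgeFinset.card ≤ ∑ x ∈ X, miss D Xᶜ x * deg D x + Xᶜ.card := by
  have hsplit := sum_filter_add_sum_filter_not X (fun x => D.Adj x y) (deg D)
  rw [sum_deg_left_eq_card_edges D X hbip] at hsplit
  have h1 : ∑ x ∈ X.filter (fun x => D.Adj x y), deg D x ≤ Xᶜ.card := by
    calc ∑ x ∈ X.filter (fun x => D.Adj x y), deg D x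
        ≤ ∑ x ∈ X.filter (fun x => D.Adj x y), Xᶜ.card := by
          apply sum_le_sum
          intro x hx
          rw [deg_eq_card_filter_compl D X hbip (mem_filter.mp hx).1]
          exact card_filter_le _ _
      _ = (X.filter (fun x => D.Adj x y)).card * Xᶜ.card := by rw [sum_const, smul_eq_mul]
      _ ≤ 1 * Xᶜ.card := by
          apply Nat.mul_le_mul_right
          rw [← deg_eq_card_filter_left D X hbip hy]
          exact hdy
      _ = Xᶜ.card := one_mul _
  have h2 : ∑ x ∈ X.filter (fun x => ¬ D.Adj x y), deg D x ≤ ∑ x ∈ X, miss D Xᶜ x * deg D x := by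
    calc ∑ x ∈ X.filter (fun x => ¬ D.Adj x y), deg D x
        ≤ ∑ x ∈ X.filter (fun x => ¬ D.Adj x y), miss D Xᶜ x * deg D x := by
          apply sum_le_sum
          intro x hx
          have hpos : 0 < miss D Xᶜ x := by
            unfold miss
            exact card_pos.mpr ⟨y, mem_filter.mpr ⟨mem_compl.mpr hy, (mem_filter.mp hx).2⟩⟩
          exact Nat.le_mul_of_pos_left _ hpos
      _ ≤ ∑ x ∈ X, miss D Xᶜ x * deg D x :=
          sum_le_sum_of_subset_of_nonneg (filter_subset _ _) (fun _ _ _ => Nat.zero_le _)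
  omega

/-- The arithmetic of the isolated-vertex case: `N + m = pq`, `2(p+q) ≤ m + 3`, `q ≤ N` and `m + 2N ≤ S + 2q`
give `3 (p + q − 4) ≤ S`. -/
theorem arith_three (p q m N S : ℕ) (h1 : N + m = p * q) (h2 : 2 * (p + q) ≤ m + 3) (h3 : q ≤ N)
    (hS : m + 2 * N ≤ S + 2 * q) : 3 * (p + q - 4) ≤ S := by
  by_cases hk : p + q ≤ 4
  · have : p + q - 4 = 0 := by omega
    rw [this]
    simp
  · -- `m ≤ (p − 1) q` with `m ≥ 2(p + q) − 3` forces `p ≥ 4`, `q ≥ 3`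
    have hp : 4 ≤ p := by
      by_contra hp
      have hp' : p ≤ 3 := by omega
      interval_cases p <;> nlinarith
    have hq : 3 ≤ q := by
      by_contra hq
      have hq' : q ≤ 2 := by omega
      interval_cases q <;> nlinarith
    obtain ⟨p', hp'⟩ : ∃ p', p = p' + 4 := ⟨p - 4, by omega⟩
    obtain ⟨q', hq'⟩ : ∃ q', q = q' + 3 := ⟨q - 3, by omega⟩
    subst hp' hq'
    have e : p' + 4 + (q' + 3) - 4 = p' + q' + 3 := by omega
    rw [e]
    nlinarith

/-- **THREE BELOW THE DIAGONAL ON EVERY BIPARTITION:** a bipartite spanning graph on `k` vertices with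
`m ≥ 2k − 3` edges and at least three missing cross pairs has `Σ_v d(v)² + 3 (k − 4) ≤ m·k`. -/
theorem bipartite_stability_three (D : SimpleGraph V) [DecidableRel D.Adj] (X : Finset V)
    (hbip : ∀ x y, D.Adj x y → (x ∈ X ↔ y ∉ X)) (hN : 3 ≤ (missing D X Xᶜ).card)
    (hm : 2 * Fintype.card V ≤ D.edgeFinset.card + 3) :
    ∑ v, deg D v * deg D v + 3 * (Fintype.card V - 4) ≤ D.edgeFinset.card * Fintype.card V := by
  have hid := two_mul_sum_deg_sq_add_sum_deficit D
  rw [card_triangles3_eq_zero_of_cliqueFree D (cliqueFree_of_bipartite D X hbip)] at hid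
  have hid2 : 2 * ∑ v, deg D v * deg D v + ∑ p ∈ adjPairsAll D, deficit D p =
      2 * (D.edgeFinset.card * Fintype.card V) := by rw [hid]; ring
  suffices h : 6 * (Fintype.card V - 4) ≤ ∑ p ∈ adjPairsAll D, deficit D p by omega
  have hG := sum_deficit_eq_two_mul_of_bipartite D X hbip
  have hk := card_add_card_compl X
  have hNm := card_missing_add_card_edges D X hbip
  by_cases hNk : (missing D X Xᶜ).card + 4 ≤ Fintype.card V
  · -- the star bound: `N₀ (k − N₀ − 1) ≥ 3 (k − 4)` for `3 ≤ N₀ ≤ k − 4`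
    have h1 := sum_deficit_ge_of_bipartite D X hbip
    obtain ⟨N, hN'⟩ : ∃ N, (missing D X Xᶜ).card = N + 3 := ⟨(missing D X Xᶜ).card - 3, by omega⟩
    obtain ⟨j, hj⟩ : ∃ j, Fintype.card V = N + 3 + 1 + (j + 3) := ⟨Fintype.card V - N - 7, by omega⟩
    rw [hN', hj] at h1
    rw [hj]
    have e1 : N + 3 + 1 + (j + 3) - (N + 3) - 1 = j + 3 := by omega
    have e2 : N + 3 + 1 + (j + 3) - 4 = N + j + 3 := by omega
    rw [e1] at h1
    rw [e2]
    nlinarith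
  · -- `N₀ ≥ k − 3`
    by_cases hlow : ∃ h ∈ missing D X Xᶜ, deg D h.1 ≤ 1 ∧ deg D h.2 ≤ 1
    · -- a missing pair with both ends of degree `≤ 1`: `G ≥ 2m − k`
      obtain ⟨⟨x, y⟩, hxy, hdx, hdy⟩ := hlow
      have hmem := hxy
      unfold missing at hmem
      rw [mem_filter, mem_product] at hmem
      obtain ⟨⟨hx, hy⟩, _⟩ := hmem
      have h1 := sum_missY_deg_ge D X hbip hx hdx
      have h2 := sum_miss_deg_ge D X hbip (mem_compl.mp hy) hdy
      omega
    · -- every missing pair has an end of degree `≥ 2`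
      have hbig : ∀ h ∈ missing D X Xᶜ, 2 ≤ deg D h.1 ∨ 2 ≤ deg D h.2 := by
        intro h hh
        by_contra hc
        exact hlow ⟨h, hh, by omega, by omega⟩
      have hsum : ∑ h ∈ missing D X Xᶜ, (deg D h.1 + deg D h.2) =
          ∑ x ∈ X, miss D Xᶜ x * deg D x + ∑ y ∈ Xᶜ, (X.filter (fun x => ¬ D.Adj x y)).card * deg D y := by
        rw [sum_add_distrib, sum_deg_fst_missing, sum_deg_snd_missing]
      by_cases hiso : ∃ z, deg D z = 0
      · obtain ⟨z, hz⟩ := hiso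
        have hzadj := not_adj_of_deg_eq_zero D hz
        by_cases hzX : z ∈ X
        · -- every `y ∉ X` misses `z` (degree `0`), hence has degree `≥ 2`
          have hy2 : ∀ y ∈ Xᶜ, 2 ≤ deg D y := by
            intro y hy
            have hmem : (z, y) ∈ missing D X Xᶜ := by
              unfold missing
              rw [mem_filter, mem_product]
              exact ⟨⟨hzX, hy⟩, hzadj y⟩
            rcases hbig (z, y) hmem with h | h
            · simp only at h; omega
            · exact h
          have hy1 : ∀ y ∈ Xᶜ, 1 ≤ (X.filter (fun x => ¬ D.Adj x y)).card := fun y _ =>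
            card_pos.mpr ⟨z, mem_filter.mpr ⟨hzX, hzadj y⟩⟩
          -- per `y`: `miss(y)·d(y) + 2 ≥ d(y) + 2·miss(y)`
          have hper : ∀ y ∈ Xᶜ, deg D y + 2 * (X.filter (fun x => ¬ D.Adj x y)).card ≤
              (X.filter (fun x => ¬ D.Adj x y)).card * deg D y + 2 := by
            intro y hy
            have h1 := hy1 y hy
            have h2 := hy2 y hy
            obtain ⟨a, ha⟩ : ∃ a, (X.filter (fun x => ¬ D.Adj x y)).card = a + 1 :=
              ⟨(X.filter (fun x => ¬ D.Adj x y)).card - 1, by omega⟩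
            obtain ⟨b, hb⟩ : ∃ b, deg D y = b + 2 := ⟨deg D y - 2, by omega⟩
            rw [ha, hb]
            nlinarith
          have hS := sum_le_sum hper
          rw [sum_add_distrib, sum_add_distrib, ← mul_sum, ← card_missing_right,
            sum_deg_right_eq_card_edges D X hbip, sum_const, smul_eq_mul] at hS
          -- `N₀ ≥ |Xᶜ|`: the pairs `(z, y)`
          have hNq : Xᶜ.card ≤ (missing D X Xᶜ).card := by
            rw [card_missing_right]
            calc Xᶜ.card = ∑ _y ∈ Xᶜ, 1 := by rw [sum_const, smul_eq_mul, mul_one]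
              _ ≤ ∑ y ∈ Xᶜ, (X.filter (fun x => ¬ D.Adj x y)).card := sum_le_sum hy1
          have harith := arith_three X.card Xᶜ.card D.edgeFinset.card (missing D X Xᶜ).card
            (∑ y ∈ Xᶜ, (X.filter (fun x => ¬ D.Adj x y)).card * deg D y) hNm (by omega) hNq
            (by omega)
          omega
        · have hzXc : z ∈ Xᶜ := mem_compl.mpr hzX
          have hx2 : ∀ x ∈ X, 2 ≤ deg D x := by
            intro x hx
            have hmem : (x, z) ∈ missing D X Xᶜ := by
              unfold missing
              rw [mem_filter, mem_product]
              exact ⟨⟨hx, hzXc⟩, fun h => hzadj x h.symm⟩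
            rcases hbig (x, z) hmem with h | h
            · exact h
            · simp only at h; omega
          have hx1 : ∀ x ∈ X, 1 ≤ miss D Xᶜ x := by
            intro x _
            unfold miss
            exact card_pos.mpr ⟨z, mem_filter.mpr ⟨hzXc, fun h => hzadj x h.symm⟩⟩
          have hper : ∀ x ∈ X, deg D x + 2 * miss D Xᶜ x ≤ miss D Xᶜ x * deg D x + 2 := by
            intro x hx
            have h1 := hx1 x hx
            have h2 := hx2 x hx
            obtain ⟨a, ha⟩ : ∃ a, miss D Xᶜ x = a + 1 := ⟨miss D Xᶜ x - 1, by omega⟩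
            obtain ⟨b, hb⟩ : ∃ b, deg D x = b + 2 := ⟨deg D x - 2, by omega⟩
            rw [ha, hb]
            nlinarith
          have hS := sum_le_sum hper
          rw [sum_add_distrib, sum_add_distrib, ← mul_sum, ← card_missing_left,
            sum_deg_left_eq_card_edges D X hbip, sum_const, smul_eq_mul] at hS
          have hNp : X.card ≤ (missing D X Xᶜ).card := by
            rw [card_missing_left]
            calc X.card = ∑ _x ∈ X, 1 := by rw [sum_const, smul_eq_mul, mul_one]
              _ ≤ ∑ x ∈ X, miss D Xᶜ x := sum_le_sum hx1
          have hNm' : (missing D X Xᶜ).card + D.edgeFinset.card = Xᶜ.card * X.card := by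
            rw [hNm, mul_comm]
          have harith := arith_three Xᶜ.card X.card D.edgeFinset.card (missing D X Xᶜ).card
            (∑ x ∈ X, miss D Xᶜ x * deg D x) hNm' (by omega) hNp (by omega)
          omega
      · -- no isolated vertex: every missing pair pays `≥ 3`
        have hpos : ∀ z, 1 ≤ deg D z := fun z => Nat.one_le_iff_ne_zero.mpr (fun h => hiso ⟨z, h⟩)
        have h3 : ∀ h ∈ missing D X Xᶜ, 3 ≤ deg D h.1 + deg D h.2 := by
          intro h hh
          have := hpos h.1
          have := hpos h.2
          rcases hbig h hh with h' | h' <;> omega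
        have hS := sum_le_sum h3
        rw [sum_const, smul_eq_mul, hsum] at hS
        omega

/-- `bipartite_stability_three` in cherries: `2·Σ_v C(d(v), 2) + 2m + 3 (k − 4) ≤ m·k`. -/
theorem bipartite_stability_three_cherries (D : SimpleGraph V) [DecidableRel D.Adj] (X : Finset V)
    (hbip : ∀ x y, D.Adj x y → (x ∈ X ↔ y ∉ X)) (hN : 3 ≤ (missing D X Xᶜ).card)
    (hm : 2 * Fintype.card V ≤ D.edgeFinset.card + 3) :
    2 * cherries D + 2 * D.edgeFinset.card + 3 * (Fintype.card V - 4) ≤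
      D.edgeFinset.card * Fintype.card V := by
  have h1 := bipartite_stability_three D X hbip hN hm
  have h2 := two_mul_cherries_add D
  have h3 := sum_deg_eq D
  omega

/-- **THREE BELOW THE DIAGONAL, BIPARTITE, EXACT:** for `1 ≤ a`, `a + 3 ≤ k`, `m = a(k − a) − 3 ≥ 2k − 3` with `m`,
`m + 1`, `m + 2` not of the form `a′(k − a′)`, the maximum of `2·Σ_v C(d(v), 2)` over the bipartite spanning graphs
on `Fin k` with `m` edges — any bipartition — is `m (k − 2) − 3 (k − 4)`, by `K_{a, k−a}` minus three edges at one
vertex. -/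
theorem three_below_diagonal_bipartite_exact (k a : ℕ) (ha : 1 ≤ a) (hak : a + 3 ≤ k)
    (hdense : 2 * k ≤ a * (k - a) - 3 + 3)
    (hm : ∀ a', a' ≤ k → a * (k - a) - 3 ≠ a' * (k - a') ∧ a * (k - a) - 2 ≠ a' * (k - a') ∧
      a * (k - a) - 1 ≠ a' * (k - a')) :
    (∀ (D : SimpleGraph (Fin k)) [DecidableRel D.Adj] (X : Finset (Fin k)),
        (∀ x y, D.Adj x y → (x ∈ X ↔ y ∉ X)) →
        D.edgeFinset.card = a * (k - a) - 3 →
        2 * cherries D + 3 * (k - 4) ≤ (a * (k - a) - 3) * (k - 2)) ∧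
      ∃ (D : SimpleGraph (Fin k)) (_ : DecidableRel D.Adj) (X : Finset (Fin k)),
        (∀ x y, D.Adj x y → (x ∈ X ↔ y ∉ X)) ∧
        D.edgeFinset.card = a * (k - a) - 3 ∧ 2 * cherries D + 3 * (k - 4) = (a * (k - a) - 3) * (k - 2) := by
  have hka : 3 ≤ a * (k - a) := by
    obtain ⟨c, hc⟩ : ∃ c, k = a + 3 + c := ⟨k - a - 3, by omega⟩
    subst hc
    have : a + 3 + c - a = 3 + c := by omega
    rw [this]
    nlinarith
  obtain ⟨m, hmm⟩ : ∃ m, a * (k - a) = m + 3 := ⟨a * (k - a) - 3, by omega⟩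
  have e1 : a * (k - a) - 3 = m := by omega
  have e2 : a * (k - a) - 2 = m + 1 := by omega
  have e3 : a * (k - a) - 1 = m + 2 := by omega
  rw [e1] at hdense hm ⊢
  rw [e2, e3] at hm
  constructor
  · intro D _ X hbip hD
    have hcard : Fintype.card (Fin k) = k := Fintype.card_fin k
    have hNX := card_missing_add_card_edges D X hbip
    have hXc : Xᶜ.card = k - X.card := by
      have := card_add_card_compl X
      rw [hcard] at this
      omega
    have hXk : X.card ≤ k := by
      have := card_le_univ X
      rwa [hcard] at this
    obtain ⟨h1, h2, h3⟩ := hm X.card hXk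
    rw [hXc] at hNX
    have hN : 3 ≤ (missing D X Xᶜ).card := by
      rw [hD] at hNX
      by_contra hlt
      have : (missing D X Xᶜ).card = 0 ∨ (missing D X Xᶜ).card = 1 ∨ (missing D X Xᶜ).card = 2 := by omega
      rcases this with h | h | h
      · rw [h] at hNX; exact h1 (by omega)
      · rw [h] at hNX; exact h2 (by omega)
      · rw [h] at hNX; exact h3 (by omega)
    have := bipartite_stability_three_cherries D X hbip hN (by rw [hcard, hD]; exact hdense)
    rw [hcard, hD] at this
    obtain ⟨k', hk'⟩ : ∃ k', k = k' + 4 := ⟨k - 4, by omega⟩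
    subst hk'
    have e4 : k' + 4 - 4 = k' := by omega
    have e5 : k' + 4 - 2 = k' + 2 := by omega
    rw [e4] at this ⊢
    rw [e5]
    nlinarith
  · refine ⟨bipMinusStar k a 3, inferInstance, univ.filter (fun i : Fin k => i.val < a),
      bipMinusStar_bipartite k a 3, ?_, ?_⟩
    · have := card_edges_bipMinusStar k a 3 ha hak
      omega
    · have h := two_mul_cherries_bipMinusStar k a 3 ha hak (by omega)
      rw [hmm] at h
      obtain ⟨k', hk'⟩ : ∃ k', k = k' + 4 := ⟨k - 4, by omega⟩
      subst hk'
      have e4 : k' + 4 - 4 = k' := by omega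
      have e5 : k' + 4 - 2 = k' + 2 := by omega
      have e6 : 2 * (k' + 4) - 3 - 3 = 2 * k' + 2 := by omega
      rw [e5, e6] at h
      rw [e4, e5]
      nlinarith

end C047

end TriangleCap

end PercRepro
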